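import Mathlib
import Summits.Ventures.PercRepro.TriangleCapSubBandInterval

/-!
# PercRepro — THE DEEP WITNESS AND THE DEEP CHAIN: THE TOP OF THE BAND ON `n` VERTICES ABOVE THE SUB-BAND `⌊t/2⌋`
(p3, gen 53; part 268)

The interior witness of part 263 (the `(t − u)`-star at the non-neighbour `1`, `u` off-edges round-robin over the
`ℓ − 1` other non-neighbours, `c` of them at leaves of the star) was stated for `2 u ≤ t`; its proof never uses that
hypothesis, only `c ≤ u` and `c + e ≤ t − u`.  Restated for every `u ≤ t` (`interiorWitness'`) it reaches the DEEP
regime `u > t/2`, where the star of `x` is the SMALLER part and the shared leaves `c ≤ t − u` are the lever.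

THE DEEP CHAIN: with `deepTop t k u = 2 u (t − u − 1) + (u (u + 1) − coll u (lfRR k 0))` (twice the top of the
`k`-carrier family of the sub-band `u`), the collision count of a round-robin grows by at most `2 u` when one index is
added (`coll_succ_le`) and never decreases (`coll_le_coll_succ`), so `deepTop (u + 1) ≤ deepTop u + 2 (t − u − 1)`
(`deepTop_succ_le`) — the interval `[deepTop (u + 1)/2 − (t − u − 1), deepTop (u + 1)/2]` of the deep witnesses at `u + 1`
overlaps the top of `u`.  An abstract chain lemma (`chain_attained`) then gives EVERY value from the top of the
sub-band `⌊t/2⌋` up to `deepTop u_b / 2` (`deep_top_attained`), and at `u_b = t − ⌈t/ℓ⌉` this top IS the extremal band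
value `C(t,2) − ℓ C(q,2) − ρ q` of part 247 (`exists_deepTop_eq_extremal`): THE BAND IS ONE INTERVAL FROM THE TOP OF
THE SUB-BAND `⌊t/2⌋` TO ITS EXTREMAL VALUE (`band_above_half_attained`), for every `2 ≤ ℓ ≤ t`, `2 t ≤ s`.
Axioms: standard.
-/

namespace PercRepro

namespace TriangleCap

namespace C047

open Finset

/-- Adding the index `u` creates at most `2 u` collision pairs: `coll (u + 1) f ≤ coll u f + 2 u`. -/
theorem coll_succ_le (u : ℕ) (f : ℕ → ℕ) : coll (u + 1) f ≤ coll u f + 2 * u := by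
  have hsub : (range (u + 1)).offDiag.filter (fun p : ℕ × ℕ => f p.1 = f p.2) ⊆
      (range u).offDiag.filter (fun p : ℕ × ℕ => f p.1 = f p.2) ∪
        ((range u).image (fun i => (i, u)) ∪ (range u).image (fun i => (u, i))) := by
    rintro ⟨a, b⟩ hp
    simp only [mem_filter, mem_offDiag, mem_range, mem_union, mem_image, Prod.mk.injEq] at hp ⊢
    obtain ⟨⟨h1, h2, h3⟩, h4⟩ := hp
    by_cases ha : a < u
    · by_cases hb : b < u
      · exact Or.inl ⟨⟨ha, hb, h3⟩, h4⟩
      · exact Or.inr (Or.inl ⟨a, ha, rfl, by omega⟩)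
    · exact Or.inr (Or.inr ⟨b, by omega, by omega, rfl⟩)
  have h1 := card_le_card hsub
  have h2 := card_union_le ((range u).offDiag.filter (fun p : ℕ × ℕ => f p.1 = f p.2))
    ((range u).image (fun i => (i, u)) ∪ (range u).image (fun i => (u, i)))
  have h3 := card_union_le ((range u).image (fun i => (i, u))) ((range u).image (fun i => (u, i)))
  have h4 := card_image_le (s := range u) (f := fun i => (i, u))
  have h5 := card_image_le (s := range u) (f := fun i => (u, i))
  rw [card_range] at h4 h5
  unfold coll
  omega

/-- The collision count never decreases with the range: `coll u f ≤ coll (u + 1) f`. -/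
theorem coll_le_coll_succ (u : ℕ) (f : ℕ → ℕ) : coll u f ≤ coll (u + 1) f := by
  unfold coll
  apply card_le_card
  apply filter_subset_filter
  apply offDiag_mono
  exact range_mono (Nat.le_succ u)

/-- **THE INTERIOR WITNESS, EVERY `u + 1 ≤ t`:** for `1 ≤ k`, `e + k + 1 ≤ ℓ`, `1 ≤ u`, `u + 1 ≤ t`, `c ≤ u`, `c + e ≤ t − u`,
`2 t ≤ s` and any `v`, the value `2 j = 2 e + 2 u (t − u − 1) + u (u + 1) − coll u (lfRR k v) − 2 c` is attained on
`ℓ + 1 + (s − t)` vertices (part 263's witness with `u + 1 ≤ t` in place of `2 u ≤ t`). -/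
theorem interiorWitness' (ℓ s t u k v e c : ℕ) (hk : 1 ≤ k) (he : e + k + 1 ≤ ℓ) (hu : 1 ≤ u) (hut : u + 1 ≤ t)
    (hc : c ≤ u) (hce : c + e ≤ t - u) (hs : 2 * t ≤ s) :
    ∃ (H : SimpleGraph (Fin (ℓ + 1 + (s - t)))) (_ : DecidableRel H.Adj), H.CliqueFree 3 ∧
      H.edgeFinset.card = s ∧ (∃ w, deg H w + t = s) ∧
      ∑ v', deg H v' * deg H v' + 2 * (t * (s - t - 1)) +
        (2 * e + 2 * (u * (t - u - 1)) + u * (u + 1) - coll u (lfRR k v) - 2 * c) = s * (s + 1) := by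
  set n := ℓ + 1 + (s - t) with hn
  have hn0 : 0 < n := by omega
  have hg : GoodEnds n (k + 2) t (lfInt t u k v) (rfInt s t u k e c) := by
    refine ⟨fun i hi => ?_, fun i hi => ?_, fun i i' hi hi' h1 h2 => ?_⟩
    · unfold lfInt
      have := lfRR_bounds k v (i - (t - u)) hk
      split_ifs <;> omega
    · rcases rfInt_cases s t u k e c i hi with ⟨hi1, hv⟩ | ⟨hi1, hi2, hv⟩ | ⟨hi1, hi2, hv⟩ |
          ⟨hi1, hi2, hv⟩ <;> rw [hv] <;> omega
    · have hb1 := lfRR_bounds k v (i - (t - u)) hk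
      have hb2 := lfRR_bounds k v (i' - (t - u)) hk
      unfold lfInt at h1
      rcases rfInt_cases s t u k e c i hi with ⟨hi1, hv⟩ | ⟨hi1, hi2, hv⟩ | ⟨hi1, hi2, hv⟩ |
          ⟨hi1, hi2, hv⟩ <;>
        rcases rfInt_cases s t u k e c i' hi' with ⟨hj1, hw⟩ | ⟨hj1, hj2, hw⟩ | ⟨hj1, hj2, hw⟩ |
          ⟨hj1, hj2, hw⟩ <;>
        rw [hv, hw] at h2 <;> split_ifs at h1 <;> omega
  have hval := genWitness_missing_value n (k + 2) s t hn0 (lfInt t u k v) (rfInt s t u k e c) hg (by omega)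
    (by omega) (by omega) (by omega)
  have hatt : ((range t).filter (fun i => rfInt s t u k e c i < k + 2 + (s - t))).card = t - e := by
    have : (range t).filter (fun i => rfInt s t u k e c i < k + 2 + (s - t)) = Ico e t := by
      ext i
      simp only [mem_filter, mem_range, mem_Ico]
      constructor
      · rintro ⟨hi, hlt⟩
        rcases rfInt_cases s t u k e c i hi with ⟨hi1, hv⟩ | ⟨hi1, hi2, hv⟩ | ⟨hi1, hi2, hv⟩ |
            ⟨hi1, hi2, hv⟩ <;> rw [hv] at hlt <;> omega
      · rintro ⟨hi1, hi2⟩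
        refine ⟨hi2, ?_⟩
        rcases rfInt_cases s t u k e c i hi2 with ⟨hi1', hv⟩ | ⟨hi1', hi2', hv⟩ | ⟨hi1', hi2', hv⟩ |
            ⟨hi1', hi2', hv⟩ <;> rw [hv] <;> omega
    rw [this, Nat.card_Ico]
  rw [hatt, coll_rfInt s t u k e c hs (by omega) hc hce, coll_lfInt t u k v (by omega) hk] at hval
  refine ⟨_, inferInstance, cliqueFree_of_bipSub _ _ (bipSub_missingGraph _ _),
    card_edges_missingGraph_genWitness n (k + 2) s t hn0 (lfInt t u k v) (rfInt s t u k e c) hg (by omega)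
      (by omega) (by omega),
    ⟨fin' n hn0 0, by
      rw [deg_missingGraph_genWitness_zero n (k + 2) s t hn0 (lfInt t u k v) (rfInt s t u k e c) hg (by omega)
        (by omega)]
      omega⟩, ?_⟩
  have e1 : t - (t - e) = e := by omega
  have hid := subband_identity t u hut
  have hcoll := coll_le u (lfRR k v)
  have hu1 : u * (u - 1) ≤ u * (u + 1) := Nat.mul_le_mul_left u (by omega)
  have e2 : t * (t - 1) - ((t - u) * (t - u - 1) + coll u (lfRR k v) + 2 * c) =
      2 * (u * (t - u - 1)) + u * (u + 1) - coll u (lfRR k v) - 2 * c := by omega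
  rw [e1, e2] at hval
  have e3 : 2 * e + 2 * (u * (t - u - 1)) + u * (u + 1) - coll u (lfRR k v) - 2 * c =
      2 * e + (2 * (u * (t - u - 1)) + u * (u + 1) - coll u (lfRR k v) - 2 * c) := by
    have e4 : u * (u + 1) = u * (u - 1) + 2 * u := by
      obtain ⟨u', rfl⟩ : ∃ u', u = u' + 1 := ⟨u - 1, by omega⟩
      rw [Nat.add_sub_cancel]
      ring
    omega
  rw [e3]
  exact hval

/-- Twice the top of the `k`-carrier family of the sub-band `u`: `2 u (t − u − 1) + (u (u + 1) − coll u (lfRR k 0))`. -/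
def deepTop (t k u : ℕ) : ℕ := 2 * (u * (t - u - 1)) + (u * (u + 1) - coll u (lfRR k 0))

/-- **THE DEEP WITNESS:** for `2 ≤ ℓ`, `1 ≤ u`, `u + 1 ≤ t`, `c ≤ u`, `c ≤ t − u`, `2 t ≤ s`, the value
`deepTop t (ℓ − 1) u − 2 c` is attained on `ℓ + 1 + (s − t)` vertices. -/
theorem deepWitness (ℓ s t u c : ℕ) (hℓ : 2 ≤ ℓ) (hu : 1 ≤ u) (hut : u + 1 ≤ t) (hc : c ≤ u) (hct : c ≤ t - u)
    (hs : 2 * t ≤ s) :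
    ∃ (H : SimpleGraph (Fin (ℓ + 1 + (s - t)))) (_ : DecidableRel H.Adj), H.CliqueFree 3 ∧
      H.edgeFinset.card = s ∧ (∃ w, deg H w + t = s) ∧
      ∑ v, deg H v * deg H v + 2 * (t * (s - t - 1)) + (deepTop t (ℓ - 1) u - 2 * c) = s * (s + 1) := by
  have h := interiorWitness' ℓ s t u (ℓ - 1) 0 0 c (by omega) (by omega) hu hut hc (by omega) hs
  unfold deepTop
  have hcoll := coll_le u (lfRR (ℓ - 1) 0)
  have hu1 : u * (u - 1) ≤ u * (u + 1) := Nat.mul_le_mul_left u (by omega)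
  have e : 2 * 0 + 2 * (u * (t - u - 1)) + u * (u + 1) - coll u (lfRR (ℓ - 1) 0) - 2 * c =
      2 * (u * (t - u - 1)) + (u * (u + 1) - coll u (lfRR (ℓ - 1) 0)) - 2 * c := by omega
  rw [e] at h
  exact h

/-- **THE DEEP STEP:** for `u + 2 ≤ t`, `deepTop t k (u + 1) ≤ deepTop t k u + 2 (t − u − 1)`. -/
theorem deepTop_succ_le (t k u : ℕ) (hu : u + 2 ≤ t) : deepTop t k (u + 1) ≤ deepTop t k u + 2 * (t - u - 1) := by
  unfold deepTop
  have hmono := coll_le_coll_succ u (lfRR k 0)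
  have hc1 := coll_le u (lfRR k 0)
  have hc2 := coll_le (u + 1) (lfRR k 0)
  obtain ⟨d, rfl⟩ : ∃ d, t = u + 2 + d := ⟨t - u - 2, by omega⟩
  have e1 : u + 2 + d - (u + 1) - 1 = d := by omega
  have e2 : u + 2 + d - u - 1 = d + 1 := by omega
  rw [e1, e2]
  have hu1 : u * (u - 1) ≤ u * (u + 1) := Nat.mul_le_mul_left u (by omega)
  have hu2 : (u + 1) * (u + 1 - 1) ≤ (u + 1) * (u + 1 + 1) := Nat.mul_le_mul_left _ (by omega)
  have e3 : (u + 1) * (u + 1 + 1) = u * (u + 1) + 2 * (u + 1) := by ring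
  have e4 : 2 * ((u + 1) * d) + 2 * (u + 1) = 2 * (u * (d + 1)) + 2 * d + 2 := by ring
  omega

/-- **THE CHAIN LEMMA:** intervals `[L u, R u]` of attained values for `a ≤ u ≤ b`, each overlapping the next
(`L (u + 1) ≤ R u + 1`), cover `[L a, R b]`. -/
theorem chain_attained (P : ℕ → Prop) (L R : ℕ → ℕ) (a b : ℕ) (hab : a ≤ b)
    (hI : ∀ u, a ≤ u → u ≤ b → ∀ j, L u ≤ j → j ≤ R u → P j)
    (hov : ∀ u, a ≤ u → u < b → L (u + 1) ≤ R u + 1) :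
    ∀ j, L a ≤ j → j ≤ R b → P j := by
  suffices key : ∀ d, ∀ u, u + d = b → a ≤ u → ∀ j, L u ≤ j → j ≤ R b → P j by
    exact key (b - a) a (by omega) le_rfl
  intro d
  induction d with
  | zero =>
    intro u hu _ j hj1 hj2
    rw [Nat.add_zero] at hu
    subst hu
    exact hI u (by omega) le_rfl j hj1 hj2
  | succ d ih =>
    intro u hu ha j hj1 hj2
    by_cases hcase : L (u + 1) ≤ j
    · exact ih (u + 1) (by omega) (by omega) j hcase hj2
    · have := hov u ha (by omega)
      exact hI u ha (by omega) j hj1 (by omega)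

/-- **THE DEEP CHAIN:** for `2 ≤ ℓ`, `1 ≤ u_a ≤ u_b`, `t ≤ 2 u_a + 2`, `u_b + 1 ≤ t`, `2 t ≤ s`, every `j` with
`deepTop t (ℓ − 1) u_a ≤ 2 j ≤ deepTop t (ℓ − 1) u_b` is attained on `ℓ + 1 + (s − t)` vertices. -/
theorem deep_top_attained (ℓ s t ua ub : ℕ) (hℓ : 2 ≤ ℓ) (hua : 1 ≤ ua) (hab : ua ≤ ub) (hta : t ≤ 2 * ua + 2)
    (hbt : ub + 1 ≤ t) (hs : 2 * t ≤ s) :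
    ∀ j, deepTop t (ℓ - 1) ua ≤ 2 * j → 2 * j ≤ deepTop t (ℓ - 1) ub →
      ∃ (H : SimpleGraph (Fin (ℓ + 1 + (s - t)))) (_ : DecidableRel H.Adj), H.CliqueFree 3 ∧
        H.edgeFinset.card = s ∧ (∃ w, deg H w + t = s) ∧
        ∑ v, deg H v * deg H v + 2 * (t * (s - t - 1)) + 2 * j = s * (s + 1) := by
  intro j hj1 hj2
  -- the intervals: at `u_a` the single top, at `u > u_a` the top minus `c ≤ t − u` shared leaves
  have hL : ∀ u, ua ≤ u → u ≤ ub → ∀ j, deepTop t (ℓ - 1) u - 2 * (if u = ua then 0 else t - u) ≤ 2 * j →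
      2 * j ≤ deepTop t (ℓ - 1) u →
      ∃ (H : SimpleGraph (Fin (ℓ + 1 + (s - t)))) (_ : DecidableRel H.Adj), H.CliqueFree 3 ∧
        H.edgeFinset.card = s ∧ (∃ w, deg H w + t = s) ∧
        ∑ v, deg H v * deg H v + 2 * (t * (s - t - 1)) + 2 * j = s * (s + 1) := by
    intro u hu1 hu2 j hj1 hj2
    obtain ⟨x, hx⟩ := coll_even u (lfRR (ℓ - 1) 0)
    obtain ⟨y, hy⟩ := Nat.even_mul_succ_self u
    have hcoll := coll_le u (lfRR (ℓ - 1) 0)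
    have hu0 : u * (u - 1) ≤ u * (u + 1) := Nat.mul_le_mul_left u (by omega)
    have heven : deepTop t (ℓ - 1) u = 2 * (u * (t - u - 1) + (y - x)) := by
      unfold deepTop
      omega
    -- the number of shared leaves `c = z − j`
    have hc1 : u * (t - u - 1) + (y - x) - j ≤ u := by
      split_ifs at hj1 with h <;> omega
    have hc2 : u * (t - u - 1) + (y - x) - j ≤ t - u := by
      split_ifs at hj1 with h <;> omega
    have hw := deepWitness ℓ s t u (u * (t - u - 1) + (y - x) - j) hℓ (by omega) (by omega) hc1 hc2 hs
    have e : deepTop t (ℓ - 1) u - 2 * (u * (t - u - 1) + (y - x) - j) = 2 * j := by omega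
    rw [e] at hw
    exact hw
  have hchain := chain_attained (fun j => ∃ (H : SimpleGraph (Fin (ℓ + 1 + (s - t)))) (_ : DecidableRel H.Adj),
      H.CliqueFree 3 ∧ H.edgeFinset.card = s ∧ (∃ w, deg H w + t = s) ∧
      ∑ v, deg H v * deg H v + 2 * (t * (s - t - 1)) + 2 * j = s * (s + 1))
    (fun u => (deepTop t (ℓ - 1) u - 2 * (if u = ua then 0 else t - u) + 1) / 2)
    (fun u => deepTop t (ℓ - 1) u / 2) ua ub hab ?_ ?_ j ?_ ?_
  · exact hchain
  · intro u hu1 hu2 j hj1 hj2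
    exact hL u hu1 hu2 j (by omega) (by omega)
  · intro u hu1 hu2
    have hstep := deepTop_succ_le t (ℓ - 1) u (by omega)
    have hne : u + 1 ≠ ua := by omega
    rw [if_neg hne]
    omega
  · rw [if_pos rfl]
    omega
  · omega

/-- **THE EXTREMAL VALUE IS A DEEP TOP:** for `2 ≤ ℓ ≤ t` there is `u_b` with `t / 2 ≤ u_b`, `u_b + 1 ≤ t` and
`deepTop t (ℓ − 1) u_b + 2 (t / ℓ) t = t (t − 1) + ℓ (t / ℓ)(t / ℓ + 1)` — `u_b = t − ⌈t / ℓ⌉`, the balanced distribution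
of the `t` off-edges over all `ℓ` non-neighbours with distinct leaves. -/
theorem exists_deepTop_eq_extremal (ℓ t : ℕ) (hℓ : 2 ≤ ℓ) (hℓt : ℓ ≤ t) :
    ∃ ub, t / 2 ≤ ub ∧ ub + 1 ≤ t ∧
      deepTop t (ℓ - 1) ub + 2 * (t / ℓ) * t = t * (t - 1) + ℓ * ((t / ℓ) * (t / ℓ + 1)) := by
  have hdiv := Nat.div_add_mod t ℓ
  have hmod := Nat.mod_lt t (show 0 < ℓ by omega)
  have hq1 : 1 ≤ t / ℓ := Nat.div_pos hℓt (by omega)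
  obtain ⟨q, hq⟩ : ∃ q, t / ℓ = q := ⟨_, rfl⟩
  obtain ⟨ρ, hρ⟩ : ∃ ρ, t % ℓ = ρ := ⟨_, rfl⟩
  rw [hq, hρ] at hdiv
  rw [hρ] at hmod
  rw [hq] at hq1 ⊢
  obtain ⟨k, rfl⟩ : ∃ k, ℓ = k + 1 := ⟨ℓ - 1, by omega⟩
  rw [Nat.add_sub_cancel]
  have hk : 0 < k := by omega
  obtain ⟨q', rfl⟩ : ∃ q', q = q' + 1 := ⟨q - 1, by omega⟩
  rcases Nat.eq_zero_or_pos ρ with rfl | hρ0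
  · -- `ρ = 0`: `u_b = k (q' + 1)`
    have ht : t = (k + 1) * (q' + 1) := by omega
    have hsplit : (k + 1) * (q' + 1) = k * (q' + 1) + (q' + 1) := by ring
    have hkq : q' + 1 ≤ k * (q' + 1) := Nat.le_mul_of_pos_left (q' + 1) hk
    refine ⟨k * (q' + 1), by omega, by omega, ?_⟩
    have hdm : k * (q' + 1) / k = q' + 1 ∧ k * (q' + 1) % k = 0 :=
      (Nat.div_mod_unique hk).mpr ⟨by ring, hk⟩
    unfold deepTop
    rw [coll_lfRR_zero k (k * (q' + 1)) hk, hdm.1, hdm.2]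
    subst ht
    have e1 : (k + 1) * (q' + 1) - k * (q' + 1) - 1 = q' := by
      have : (k + 1) * (q' + 1) = k * (q' + 1) + q' + 1 := by ring
      omega
    have e2 : (k + 1) * (q' + 1) - 1 = k * (q' + 1) + q' := by
      have : (k + 1) * (q' + 1) = k * (q' + 1) + q' + 1 := by ring
      omega
    rw [e1, e2, Nat.add_sub_cancel]
    have h1 : k * ((q' + 1) * q') + 2 * (0 * (q' + 1)) ≤ k * (q' + 1) * (k * (q' + 1) + 1) := by
      have h0 : k * ((q' + 1) * q') = k * (q' + 1) * q' := by ring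
      rw [h0, zero_mul, mul_zero, add_zero]
      exact Nat.mul_le_mul_left _ (by omega)
    zify [h1]
    ring
  · -- `ρ ≥ 1`: `u_b = k (q' + 1) + (ρ − 1)`
    obtain ⟨ρ', rfl⟩ : ∃ ρ', ρ = ρ' + 1 := ⟨ρ - 1, by omega⟩
    have ht : t = (k + 1) * (q' + 1) + ρ' + 1 := by omega
    have hsplit : (k + 1) * (q' + 1) = k * (q' + 1) + (q' + 1) := by ring
    have hkq : q' + 1 ≤ k * (q' + 1) := Nat.le_mul_of_pos_left (q' + 1) hk
    refine ⟨k * (q' + 1) + ρ', by omega, by omega, ?_⟩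
    have hdm : (k * (q' + 1) + ρ') / k = q' + 1 ∧ (k * (q' + 1) + ρ') % k = ρ' :=
      (Nat.div_mod_unique hk).mpr ⟨by ring, by omega⟩
    unfold deepTop
    rw [coll_lfRR_zero k (k * (q' + 1) + ρ') hk, hdm.1, hdm.2]
    subst ht
    have e1 : (k + 1) * (q' + 1) + ρ' + 1 - (k * (q' + 1) + ρ') - 1 = q' + 1 := by
      have : (k + 1) * (q' + 1) = k * (q' + 1) + q' + 1 := by ring
      omega
    have e2 : (k + 1) * (q' + 1) + ρ' + 1 - 1 = (k + 1) * (q' + 1) + ρ' := by omega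
    rw [e1, e2, Nat.add_sub_cancel]
    have h1 : k * ((q' + 1) * q') + 2 * (ρ' * (q' + 1)) ≤
        (k * (q' + 1) + ρ') * (k * (q' + 1) + ρ' + 1) := by nlinarith
    zify [h1]
    ring

/-- **THE BAND IS ONE INTERVAL ABOVE THE SUB-BAND `⌊t/2⌋`:** for `2 ≤ ℓ ≤ t`, `2 ≤ t`, `2 t ≤ s`, every `j` with
`deepTop t (ℓ − 1) (t / 2) ≤ 2 j` (the top of the `(ℓ − 1)`-carrier family of the sub-band `⌊t/2⌋`) and
`2 j + 2 (t / ℓ) t ≤ t (t − 1) + ℓ (t / ℓ)(t / ℓ + 1)` (the extremal bound of part 247) is attained on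
`ℓ + 1 + (s − t)` vertices. -/
theorem band_above_half_attained (ℓ s t : ℕ) (hℓ : 2 ≤ ℓ) (hℓt : ℓ ≤ t) (hs : 2 * t ≤ s) :
    ∀ j, deepTop t (ℓ - 1) (t / 2) ≤ 2 * j → 2 * j + 2 * (t / ℓ) * t ≤ t * (t - 1) + ℓ * ((t / ℓ) * (t / ℓ + 1)) →
      ∃ (H : SimpleGraph (Fin (ℓ + 1 + (s - t)))) (_ : DecidableRel H.Adj), H.CliqueFree 3 ∧
        H.edgeFinset.card = s ∧ (∃ w, deg H w + t = s) ∧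
        ∑ v, deg H v * deg H v + 2 * (t * (s - t - 1)) + 2 * j = s * (s + 1) := by
  intro j hj1 hj2
  obtain ⟨ub, hub1, hub2, hub3⟩ := exists_deepTop_eq_extremal ℓ t hℓ hℓt
  exact deep_top_attained ℓ s t (t / 2) ub hℓ (by omega) hub1 (by omega) hub2 hs j hj1 (by omega)

end C047

end TriangleCap

end PercRepro
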